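import Summits.QuantumFields.BalabanUV.Beta.EriceRemainderEnclosureHistoryAutonomyComparisonAgeCompositionChainWiringTerms
import Summits.QuantumFields.BalabanUV.Beta.EriceRemainderEnclosureHistoryAutonomyComparisonAgeCompositionReadDecay

/-!
# EriceRemainderEnclosureHistoryAutonomyComparisonAgeCompositionReadMonotone — (E81c) MONOa IS STATIC: a non-negative kernel whose PARTIAL ROW SUMS
# DOMINATE THE SHIFTED PARTIAL ROW SUMS OF THE NEXT ROW (`Σ_{l≤L} K (n+1) l ≤ Σ_{l≤L+1} K n l`) maps non-negative non-increasing sequences to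
# non-increasing reads (Abel summation); for a window kernel this is «shift domination inside the window ∧ ROW MASS NON-INCREASING IN THE PIN»; hence
# MONOa ⟸ MONO″ ∧ «the old ages' damped row masses do not increase with the pin», and route (N)'s first-order induction is RESHAPED: its two
# monotonicity hypotheses become ONE conditional one (MONO″ given KEY) and ONE static one (cumulative domination of the old aggregate kernel)

Cell `pub-balaban`, β-function sub-cell, BINDER row D4 «RemainderConst leaves for Bałaban's split» (`HOME/BINDER-OWNERS.md`; owner lineage `b2b-balaban-beta-an4`;
this file by co-owner #2 lineage `b2b-balaban-beta-d4-p2`, generation 72), β-FLOW TEAM duty (1), FREEZE (0) honoured (def-free; imports (E80f)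
`…ChainWiringTerms`, (E81a) `…ReadDecay`; uses (E71a) `read_nonneg`∕`read_le_read`∕`sol_nonneg_le_of_supersol`∕`sol_unique`∕`nonneg_of_age_composition_antitone`,
(E71b) `aggregate_read_succ`∕`aggregate_sol_top`, (E71d) `surplus_sandwich`∕`drop_ratio_step`, (E80d) `key_ratio_of_drop_ratios`∕`aggregate_eq_sum`, (E80f)
`antitone_young_drops`, (E81a) `young_drops_antitone_of_read_decay` BY NAME; §4 is (E80f) §2 with two hypotheses reshaped; nothing restated).

HONEST FRAMING (page 1, verbatim and binding).  *"Discharging BetaPertH makes Bałaban's UV stability UNCONDITIONAL — a real constructive-QFT result; it is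
NOT the continuum limit and NOT the Clay problem."*  THIS FILE DISCHARGES NOTHING OF THE KIND.  Elementary real algebra about ABSTRACT triangular renewal
systems — hypotheses of a census, not facts; the age profile of Bałaban's (1.22) limit functional is NOT PRINTED ([I] p. 298; GAPS G-t4-U2-1∕-2) and NOT
asserted.  Row D4 class UNCHANGED (critical-path width 0; instance 0∕1; D4 DISCHARGE NO DATE).  HONEST DEPENDENCY: continuum YM on T⁴ ⇐ BetaPertH ∧ nine
spine estimates (0/9 proved); BetaPertH ⇐ (D1) ∧ (D4) ∧ CAP+tail; G-an2-4 gates asym, D1 and NE2/3/4.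

THE POINT (census sense (α); route (N); this station's README `g72/e81/README.md`).  After (E80f) the first-order remainder of route (N) was MONO″ (young
drops of the young solution of the old surplus non-increasing) and MONOa (their OLD READS non-increasing).  MONOa asks that the old aggregate kernel map a
non-negative NON-INCREASING sequence (the young drops, by MONO″) to a non-increasing read; a kernel does this for every such input iff its partial row sums
up to a fixed absolute target do not increase with the pin: **`Σ_{l≤L} K (n+1) l ≤ Σ_{l≤L+1} K n l`** (CUMULATIVE DOMINATION; §2 `read_antitone_of_cum_dom`,
by the Abel summation §1).  For a window kernel with SHIFT DOMINATION inside the window (`K (n+1) l ≤ K n (l+1)`, automatic for the flow's lone kernels: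
coefficient non-increasing, dampings `≤ 1`) this is exactly «THE ROW MASS DOES NOT INCREASE WITH THE PIN» (§3 `cum_dom_of_window`), additive over ages
(`cum_dom_aggregate`).  NUMERICS OF RECORD (`g72/numerics/m13.py`, `m14.py`: towers, pairs, clusters, dense sets, a saturated youngest age with an old age
`k ≤ 1000`; dampings self-consistent ∕ none ∕ lower envelope ∕ alternating in the relaxed class): the damped row mass `x̃^k_n = c_{n,k}Σ_{l<k}Π_{t=n+1+l}^{n+k}g_t`
of EVERY age is non-increasing in the pin in every case (`max_n x̃^k_{n+1}∕x̃^k_n` from 0.970 to 0.9994); MONOa itself: 0 violations.  So MONOa IS A STATIC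
PROPERTY OF THE FLOW modulo MONO″.  §4 RESHAPES (E80f)'s induction: **`nonneg_and_drop_ratio_all_ages_of_criteria`** ∕ **`nonneg_of_chain_closes_of_criteria`**
take, instead of `hMONOa`∕`hMONO2`, (a) the STATIC cumulative domination of the lone kernels and (b) MONO″ in CONDITIONAL form — GIVEN that the old surplus
`v = SA (i+1) w` is non-negative and a supersolution of the young kernel (KEY_i; both available inside the induction before MONO is used); (b) is what (E81a)
`young_drops_antitone_of_read_decay` discharges from a read-decay inequality, and §5 **`nonneg_of_chain_closes_of_read_decay`** states the END with (b) so
replaced (`U = RL i v`).  LEFT OF ROUTE (N) AT FIRST ORDER after this file: two STATIC-TYPE families — the read-decay inequality for the young reads of old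
surpluses, and the row-mass monotonicity of the flow's lone kernels ((E81d): age `1`).  NOT CLAIMED: either for the flow in general; anything printed.

WHAT IS PROVED ([folklore]; 0 `def`, 0 sorry).  §1 `antitone_chain`, **`abel_nonneg`**.  §2 **`read_antitone_of_cum_dom`**.  §3 `cum_dom_of_window`,
`cum_dom_add`, `cum_dom_aggregate`.  §4 **`nonneg_and_drop_ratio_all_ages_of_criteria`**, **`nonneg_of_chain_closes_of_criteria`**.  §5
**`nonneg_of_chain_closes_of_read_decay`**.
-/
noncomputable section
open Finset

namespace Summit.QuantumFields.BalabanUV.Beta.EriceRemainderEnclosureHistoryAutonomyComparisonAgeCompositionReadMonotone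

open Summit.QuantumFields.BalabanUV.Beta.EriceRemainderEnclosureHistoryAutonomyComparisonAgeComposition
open Summit.QuantumFields.BalabanUV.Beta.EriceRemainderEnclosureHistoryAutonomyComparisonAgeCompositionInduction
open Summit.QuantumFields.BalabanUV.Beta.EriceRemainderEnclosureHistoryAutonomyComparisonAgeCompositionSandwich
open Summit.QuantumFields.BalabanUV.Beta.EriceRemainderEnclosureHistoryAutonomyComparisonAgeCompositionChainWiring
open Summit.QuantumFields.BalabanUV.Beta.EriceRemainderEnclosureHistoryAutonomyComparisonAgeCompositionChainWiringTerms
open Summit.QuantumFields.BalabanUV.Beta.EriceRemainderEnclosureHistoryAutonomyComparisonAgeCompositionReadDecay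

/-! ## §1 Abel summation against a non-increasing non-negative weight -/

/-- A sequence non-increasing below `N` decreases along `[l, N)`. [folklore] -/
theorem antitone_chain {N : ℕ} {b : ℕ → ℝ} (hba : ∀ l, l + 1 < N → b (l + 1) ≤ b l) {l : ℕ} : ∀ j, l + j < N → b (l + j) ≤ b l := by
  intro j
  induction j with
  | zero => intro _; simp
  | succ j ih => intro hj; exact (by rw [← add_assoc]; exact hba _ (by omega) : b (l + (j + 1)) ≤ b (l + j)).trans (ih (by omega))

/-- **ABEL.**  If the partial sums of `x` over `[0, L]` are non-negative for every `L < N` and `b` is non-negative and non-increasing below `N`, then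
`Σ_{l<N} x l · b l ≥ 0`. [folklore] -/
theorem abel_nonneg : ∀ (N : ℕ) (x b : ℕ → ℝ), (∀ L, L < N → 0 ≤ ∑ i ∈ range (L + 1), x i) →
    (∀ l, l < N → 0 ≤ b l) → (∀ l, l + 1 < N → b (l + 1) ≤ b l) → 0 ≤ ∑ l ∈ range N, x l * b l := by
  intro N
  induction N with
  | zero => intro x b _ _ _; simp
  | succ N ih =>
    intro x b hX hb0 hba
    have hsplit' : ∑ l ∈ range (N + 1), x l * b l = ∑ l ∈ range N, x l * (b l - b N) + b N * ∑ l ∈ range (N + 1), x l := by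
      have e1 : ∑ l ∈ range N, x l * (b l - b N) = ∑ l ∈ range N, x l * b l - b N * ∑ l ∈ range N, x l := by
        rw [mul_sum, ← sum_sub_distrib]; exact sum_congr rfl fun l _ => by ring
      rw [e1, sum_range_succ, sum_range_succ (fun l => x l)]
      ring
    rw [hsplit']
    refine add_nonneg ?_ (mul_nonneg (hb0 N (by omega)) (hX N (by omega)))
    refine ih x (fun l => b l - b N) (fun L hL => hX L (by omega)) (fun l hl => ?_) (fun l hl => ?_)
    · have := antitone_chain hba (l := l) (N - l) (by omega)
      rw [show l + (N - l) = N by omega] at this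
      linarith
    · have := hba l (by omega); linarith

/-! ## §2 Cumulative domination ⟹ reads of non-increasing non-negative sequences are non-increasing -/

/-- **READS PRESERVE MONOTONICITY UNDER CUMULATIVE DOMINATION.**  Non-negative kernel `K` on the horizon `N` (entries vanish from the lag `N` on) whose
partial row sums dominate the shifted partial row sums of the next row: `Σ_{l≤L} K (n+1) l ≤ Σ_{l≤L+1} K n l` for all `n, L`.  Then for every non-negative
non-increasing `d` the reads `R d n = Σ_{l<N} K n l · d (n+1+l)` are NON-INCREASING in the pin.  (Align both rows on the targets `n+2+l`; the leaving
target's weight `K n 0` joins the first aligned weight since `d (n+1) ≥ d (n+2)`; then Abel.) [folklore] -/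
theorem read_antitone_of_cum_dom {N : ℕ} {K : ℕ → ℕ → ℝ} {R : (ℕ → ℝ) → ℕ → ℝ}
    (hR : ∀ v n, R v n = ∑ l ∈ range N, K n l * v (n + 1 + l)) (hK : ∀ n l, 0 ≤ K n l) (hKN : ∀ n l, N ≤ l → K n l = 0)
    (hcum : ∀ n L, ∑ l ∈ range (L + 1), K (n + 1) l ≤ ∑ l ∈ range (L + 2), K n l)
    {d : ℕ → ℝ} (hd0 : ∀ m, 0 ≤ d m) (hda : ∀ m, d (m + 1) ≤ d m) : ∀ n, R d (n + 1) ≤ R d n := by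
  intro n
  rcases Nat.eq_zero_or_pos N with hN | hN
  · subst hN; rw [hR, hR]; simp
  obtain ⟨N', rfl⟩ : ∃ N', N = N' + 1 := ⟨N - 1, by omega⟩
  -- aligned weights a l = K n (l+1) + [l = 0] K n 0 on the targets n+2+l
  set a : ℕ → ℝ := fun l => K n (l + 1) + if l = 0 then K n 0 else 0 with ha
  have hlow : ∑ l ∈ range (N' + 1), a l * d (n + 2 + l) ≤ R d n := by
    have eL : ∑ l ∈ range (N' + 1), a l * d (n + 2 + l) = ∑ l ∈ range (N' + 1), K n (l + 1) * d (n + 2 + l) + K n 0 * d (n + 2) := by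
      rw [show (fun l => a l * d (n + 2 + l)) = fun l => K n (l + 1) * d (n + 2 + l) + (if l = 0 then K n 0 * d (n + 2 + l) else 0) from
        funext fun l => by simp only [ha]; split_ifs <;> ring, sum_add_distrib, sum_ite_eq', if_pos (mem_range.mpr (Nat.succ_pos _)), add_zero]
    have eT : ∑ l ∈ range (N' + 1), K n (l + 1) * d (n + 2 + l) = ∑ l ∈ range N', K n (l + 1) * d (n + 2 + l) := by
      rw [sum_range_succ, hKN n (N' + 1) le_rfl, zero_mul, add_zero]
    have eR : R d n = K n 0 * d (n + 1) + ∑ l ∈ range N', K n (l + 1) * d (n + 2 + l) := by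
      rw [hR, sum_range_succ', add_comm]
      simp only [add_zero]
      congr 1
      exact sum_congr rfl fun l _ => by rw [show n + 1 + (l + 1) = n + 2 + l by omega]
    rw [eL, eT, eR]
    have := mul_le_mul_of_nonneg_left (hda (n + 1)) (hK n 0)
    rw [show n + 1 + 1 = n + 2 by ring] at this
    linarith
  have hup : R d (n + 1) = ∑ l ∈ range (N' + 1), K (n + 1) l * d (n + 2 + l) := by
    rw [hR]
  -- Abel with x = a − K (n+1) ·
  have habel := abel_nonneg (N' + 1) (fun l => a l - K (n + 1) l) (fun l => d (n + 2 + l))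
    (fun L _ => by
      rw [sum_sub_distrib, sub_nonneg]
      simp only [ha]
      rw [sum_add_distrib, sum_ite_eq' (range (L + 1)) 0 (fun _ => K n 0), if_pos (mem_range.mpr (by omega))]
      have := hcum n L
      rw [sum_range_succ' (fun l => K n l)] at this
      linarith)
    (fun l _ => hd0 _) (fun l _ => by rw [show n + 2 + (l + 1) = n + 2 + l + 1 by ring]; exact hda _)
  have e4 : ∑ l ∈ range (N' + 1), (a l - K (n + 1) l) * d (n + 2 + l) =
      ∑ l ∈ range (N' + 1), a l * d (n + 2 + l) - ∑ l ∈ range (N' + 1), K (n + 1) l * d (n + 2 + l) := by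
    rw [← sum_sub_distrib]; exact sum_congr rfl fun l _ => by ring
  rw [e4] at habel
  linarith

/-! ## §3 Cumulative domination for window kernels and aggregates -/

/-- **WINDOW KERNELS: shift domination inside the window ∧ row mass non-increasing ⟹ cumulative domination.**  `K n l = 0` for `l ≥ y`;
`K (n+1) l ≤ K n (l+1)` for `l + 1 < y`; `Σ_{l<y} K (n+1) l ≤ Σ_{l<y} K n l`.  Then `Σ_{l≤L} K (n+1) l ≤ Σ_{l≤L+1} K n l` for every `L`. [folklore] -/
theorem cum_dom_of_window {K : ℕ → ℕ → ℝ} {y : ℕ} (hK : ∀ n l, 0 ≤ K n l) (hKy : ∀ n l, y ≤ l → K n l = 0)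
    (hshift : ∀ n l, l + 1 < y → K (n + 1) l ≤ K n (l + 1)) (hrow : ∀ n, ∑ l ∈ range y, K (n + 1) l ≤ ∑ l ∈ range y, K n l) (n L : ℕ) :
    ∑ l ∈ range (L + 1), K (n + 1) l ≤ ∑ l ∈ range (L + 2), K n l := by
  -- rows are supported in `range y`: partial sums beyond `y` are full rows
  have hfull : ∀ n' M, y ≤ M → ∑ l ∈ range M, K n' l = ∑ l ∈ range y, K n' l := by
    intro n' M hM
    rw [← sum_range_add_sum_Ico _ hM, sum_eq_zero (s := Ico y M) fun l hl => hKy n' l (mem_Ico.mp hl).1, add_zero]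
  rcases Nat.lt_or_ge (L + 1) y with hL | hL
  · -- inside the window: termwise shift domination, then one extra non-negative term
    rw [sum_range_succ' (fun l => K n l)]
    have h1 : ∑ l ∈ range (L + 1), K (n + 1) l ≤ ∑ l ∈ range (L + 1), K n (l + 1) :=
      sum_le_sum fun l hl => hshift n l (by have := mem_range.mp hl; omega)
    linarith [hK n 0]
  · rw [hfull (n + 1) (L + 1) hL, hfull n (L + 2) (by omega)]
    exact hrow n

/-- Cumulative domination is additive over kernels. [folklore] -/
theorem cum_dom_add {K K' : ℕ → ℕ → ℝ}
    (h1 : ∀ n L, ∑ l ∈ range (L + 1), K (n + 1) l ≤ ∑ l ∈ range (L + 2), K n l)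
    (h2 : ∀ n L, ∑ l ∈ range (L + 1), K' (n + 1) l ≤ ∑ l ∈ range (L + 2), K' n l) (n L : ℕ) :
    ∑ l ∈ range (L + 1), (K (n + 1) l + K' (n + 1) l) ≤ ∑ l ∈ range (L + 2), (K n l + K' n l) := by
  rw [sum_add_distrib, sum_add_distrib]; exact add_le_add (h1 n L) (h2 n L)

/-- **AGGREGATES.**  If every lone kernel `KL k` (`i ≤ k ≤ n`) has cumulative domination then so has the aggregate `KA i = Σ_{k≥i} KL k`
(`KA i = KL i + KA (i+1)`, `KA (n+1) = 0`). [folklore] -/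
theorem cum_dom_aggregate {n : ℕ} {KL KA : ℕ → ℕ → ℕ → ℝ}
    (hKA : ∀ i m l, KA i m l = KL i m l + KA (i + 1) m l) (hKAtop : ∀ m l, KA (n + 1) m l = 0)
    (hcum : ∀ k, 1 ≤ k → k ≤ n → ∀ m L, ∑ l ∈ range (L + 1), KL k (m + 1) l ≤ ∑ l ∈ range (L + 2), KL k m l)
    {i : ℕ} (hi1 : 1 ≤ i) (hi : i ≤ n + 1) (m L : ℕ) :
    ∑ l ∈ range (L + 1), KA i (m + 1) l ≤ ∑ l ∈ range (L + 2), KA i m l := by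
  obtain ⟨d, rfl⟩ : ∃ d, i = n + 1 - d := ⟨n + 1 - i, by omega⟩
  have key : ∀ d, d ≤ n → ∀ m L, ∑ l ∈ range (L + 1), KA (n + 1 - d) (m + 1) l ≤ ∑ l ∈ range (L + 2), KA (n + 1 - d) m l := by
    intro d
    induction d with
    | zero => intro _ m L; simp [hKAtop]
    | succ d ih =>
      intro hd m L
      have e : ∀ m' l, KA (n + 1 - (d + 1)) m' l = KL (n + 1 - (d + 1)) m' l + KA (n + 1 - d) m' l := fun m' l => by
        rw [hKA, show n + 1 - (d + 1) + 1 = n + 1 - d by omega]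
      simp only [e]
      exact cum_dom_add (hcum _ (by omega) (by omega)) (ih (by omega)) m L
  exact key d (by omega) m L

/-! ## §4 The joint induction RESHAPED: MONO″ conditional on KEY, MONOa replaced by cumulative domination -/

section Induction

variable {N n : ℕ} {KL KA : ℕ → ℕ → ℕ → ℝ} {RL RA SL SA : ℕ → (ℕ → ℝ) → ℕ → ℝ} {y : ℕ → ℕ} {θ : ℕ → ℕ → ℕ → ℝ}

/-- **THE JOINT INDUCTION WITH STATIC MONOa AND CONDITIONAL MONO″.**  (E80f) `nonneg_and_drop_ratio_all_ages_of_mono2` with `hMONOa` replaced by the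
CUMULATIVE DOMINATION of the old aggregate kernels `KA (i+1)` (a property of the kernels alone) and `hMONO2` asked only CONDITIONALLY: for each age `i` and
admissible `w`, given that the old surplus `SA (i+1) w` is non-negative and a supersolution of the young kernel (both derived inside the induction before
use), the young drops `RL i (SL i (SA (i+1) w))` are non-increasing.  MONOa then follows inside by `read_antitone_of_cum_dom` (the drops are `≥ 0` by KEY).
Same conclusion. [folklore] -/
theorem nonneg_and_drop_ratio_all_ages_of_criteria
    (hKL : ∀ i m l, 0 ≤ KL i m l) (hKLN : ∀ i m l, N ≤ l → KL i m l = 0) (hKLy : ∀ i m l, y i ≤ l → KL i m l = 0)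
    (hRL : ∀ i v m, RL i v m = ∑ l ∈ range N, KL i m l * v (m + 1 + l))
    (hRA : ∀ i v m, RA i v m = ∑ l ∈ range N, KA i m l * v (m + 1 + l))
    (hKA : ∀ i m l, KA i m l = KL i m l + KA (i + 1) m l) (hKAtop : ∀ m l, KA (n + 1) m l = 0)
    (hSL : ∀ i (w : ℕ → ℝ), (∀ m, N < m → w m = 0) → (∀ m, N < m → SL i w m = 0) ∧ ∀ m, SL i w m = w m - RL i (SL i w) m)
    (hSA : ∀ i (w : ℕ → ℝ), (∀ m, N < m → w m = 0) → (∀ m, N < m → SA i w m = 0) ∧ ∀ m, SA i w m = w m - RA i (SA i w) m)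
    (hy : ∀ i, 1 ≤ i → i ≤ n → 1 ≤ y i ∧ y i ≤ N)
    (hθ0 : ∀ k m l, 0 ≤ θ k m l) (hpers : ∀ k m l i', (1 - θ k m l) * KL k m (i' + l) ≤ KL k (m + l) i')
    (hθmono : ∀ k m l l', l ≤ l' → θ k m l ≤ θ k m l')
    {ρ : ℕ → ℕ → ℝ} {β : ℕ → ℕ → ℕ → ℝ}
    (hρ : ∀ i m, 1 ≤ i → i ≤ n → ρ i m = (∑ l ∈ range N, KL i m l) * (1 + ∑ k ∈ Ioc i n, θ k m (y i) * β (i + 1) m k) /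
      (1 - ∑ k ∈ Ioc i n, ∑ l ∈ range (y i), KL k m l))
    (hβnew : ∀ i m, 1 ≤ i → i ≤ n → β i m i = ρ i m / (1 - ρ i m))
    (hβold : ∀ i m k, 1 ≤ i → i < k → k ≤ n → β i m k = β (i + 1) m k / (1 - ρ i m))
    (hΩ1 : ∀ i m, 1 ≤ i → i ≤ n → ∑ k ∈ Ioc i n, ∑ l ∈ range (y i), KL k m l < 1)
    (hclose : ∀ i m, 1 ≤ i → i ≤ n → ρ i m < 1)
    (hcumL : ∀ k, 1 ≤ k → k ≤ n → ∀ m L, ∑ l ∈ range (L + 1), KL k (m + 1) l ≤ ∑ l ∈ range (L + 2), KL k m l)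
    (hMONO2c : ∀ i, 1 ≤ i → i ≤ n → ∀ w : ℕ → ℝ, (∀ m, 0 ≤ w m) → (∀ m, w (m + 1) ≤ w m) → (∀ m, N < m → w m = 0) →
      (∀ m, 0 ≤ SA (i + 1) w m) → (∀ m, RL i (SA (i + 1) w) m ≤ SA (i + 1) w m) →
      ∀ m, RL i (SL i (SA (i + 1) w)) (m + 1) ≤ RL i (SL i (SA (i + 1) w)) m) :
    ∀ i, 1 ≤ i → i ≤ n + 1 →
      (∀ m k, i ≤ k → k ≤ n → 0 ≤ β i m k) ∧
      ∀ w : ℕ → ℝ, (∀ m, 0 ≤ w m) → (∀ m, w (m + 1) ≤ w m) → (∀ m, N < m → w m = 0) →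
        (∀ m, 0 ≤ SA i w m) ∧ (∀ m k, i ≤ k → k ≤ n → RL k (SA i w) m ≤ β i m k * SA i w m) := by
  suffices h : ∀ d i, i + d = n + 1 → 1 ≤ i →
      (∀ m k, i ≤ k → k ≤ n → 0 ≤ β i m k) ∧
      ∀ w : ℕ → ℝ, (∀ m, 0 ≤ w m) → (∀ m, w (m + 1) ≤ w m) → (∀ m, N < m → w m = 0) →
        (∀ m, 0 ≤ SA i w m) ∧ (∀ m k, i ≤ k → k ≤ n → RL k (SA i w) m ≤ β i m k * SA i w m) from
    fun i hi hin => h (n + 1 - i) i (by omega) hi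
  intro d
  induction d with
  | zero =>
    intro i hi _
    have : i = n + 1 := by omega
    subst this
    refine ⟨fun m k hk hkn => by omega, fun w hw0 _ hwt => ⟨fun m => ?_, fun m k hk hkn => by omega⟩⟩
    rw [aggregate_sol_top hRA hKAtop hSA hwt m]; exact hw0 m
  | succ d ih =>
    intro i hi hi1
    have hin : i ≤ n := by omega
    obtain ⟨hBN, hIH⟩ := ih (i + 1) (by omega) (by omega)
    obtain ⟨hy1, hyN⟩ := hy i hi1 hin
    have hx0 : ∀ m, 0 ≤ ∑ l ∈ range N, KL i m l := fun m => sum_nonneg fun l _ => hKL i m l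
    have hV0 : ∀ m, 0 ≤ ∑ k ∈ Ioc i n, θ k m (y i) * β (i + 1) m k := fun m =>
      sum_nonneg fun k hk => mul_nonneg (hθ0 k m _) (hBN m k (by have := (mem_Ioc.mp hk).1; omega) (mem_Ioc.mp hk).2)
    have hρ0 : ∀ m, 0 ≤ ρ i m := fun m => by
      rw [hρ i m hi1 hin]
      exact div_nonneg (mul_nonneg (hx0 m) (by linarith [hV0 m])) (by linarith [hΩ1 i m hi1 hin])
    have hρ1 : ∀ m, ρ i m < 1 := fun m => hclose i m hi1 hin
    -- (A) KEY_i WITH THE RATIO ρ_i(m)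
    have hkey : ∀ w : ℕ → ℝ, (∀ m, 0 ≤ w m) → (∀ m, w (m + 1) ≤ w m) → (∀ m, N < m → w m = 0) →
        ∀ m, RL i (SA (i + 1) w) m ≤ ρ i m * SA (i + 1) w m := by
      intro w hw0 hwa hwt m
      obtain ⟨hP, hDR⟩ := hIH w hw0 hwa hwt
      have h := (key_ratio_of_drop_ratios hKL hKLN hKLy hRL hRA hKA hKAtop hθ0 hpers hθmono hin hy1 hyN hP hwa
        (fun m' => (hSA (i + 1) w hwt).2 m') (m := m) (β := fun k => β (i + 1) m k)
        (fun k hk hkn => hDR m k (by omega) hkn) (hΩ1 i m hi1 hin)).2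
      rw [hρ i m hi1 hin]
      exact h
    have hKEY : ∀ w : ℕ → ℝ, (∀ m, 0 ≤ w m) → (∀ m, w (m + 1) ≤ w m) → (∀ m, N < m → w m = 0) →
        ∀ m, RL i (SA (i + 1) w) m ≤ SA (i + 1) w m := by
      intro w hw0 hwa hwt m
      have h1 := hkey w hw0 hwa hwt m
      have h2 := (hIH w hw0 hwa hwt).1 m
      nlinarith [hρ1 m]
    -- the old aggregate kernel: signs, horizon, cumulative domination
    have hKA0 : ∀ m l, 0 ≤ KA (i + 1) m l := fun m l => by
      rw [aggregate_eq_sum hKA hKAtop (by omega : i + 1 ≤ n + 1)]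
      exact sum_nonneg fun k _ => hKL k m l
    have hKAN : ∀ m l, N ≤ l → KA (i + 1) m l = 0 := fun m l hl => by
      rw [aggregate_eq_sum hKA hKAtop (by omega : i + 1 ≤ n + 1)]
      exact sum_eq_zero fun k _ => hKLN k m l hl
    have hcumA := cum_dom_aggregate hKA hKAtop hcumL (i := i + 1) (by omega) (by omega)
    -- MONO_i in full, from KEY_i (signs), conditional MONO″ and the STATIC cumulative domination (MONOa)
    have hMONO2 : ∀ w : ℕ → ℝ, (∀ m, 0 ≤ w m) → (∀ m, w (m + 1) ≤ w m) → (∀ m, N < m → w m = 0) →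
        ∀ m, RL i (SL i (SA (i + 1) w)) (m + 1) ≤ RL i (SL i (SA (i + 1) w)) m :=
      fun w hw0 hwa hwt => hMONO2c i hi1 hin w hw0 hwa hwt (hIH w hw0 hwa hwt).1 (hKEY w hw0 hwa hwt)
    have hMONO : ∀ w : ℕ → ℝ, (∀ m, 0 ≤ w m) → (∀ m, w (m + 1) ≤ w m) → (∀ m, N < m → w m = 0) →
        (∀ m, 0 ≤ RA (i + 1) (RL i (SL i (SA (i + 1) w))) m) ∧
        (∀ m, RA (i + 1) (RL i (SL i (SA (i + 1) w))) (m + 1) ≤ RA (i + 1) (RL i (SL i (SA (i + 1) w))) m) := by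
      intro w hw0 hwa hwt
      have hvt := (hSA (i + 1) w hwt).1
      have ht := sol_nonneg_le_of_supersol (hRL i) (hKL i) (hIH w hw0 hwa hwt).1 (hKEY w hw0 hwa hwt) (hSL i _ hvt).1 (hSL i _ hvt).2
      have hd0 : ∀ m, 0 ≤ RL i (SL i (SA (i + 1) w)) m := fun m => read_nonneg (hRL i) (hKL i) (fun m' _ => (ht m').1)
      exact ⟨fun m => read_nonneg (hRA (i + 1)) hKA0 (fun m' _ => hd0 m'),
        read_antitone_of_cum_dom (hRA (i + 1)) hKA0 hKAN hcumA hd0 (hMONO2 w hw0 hwa hwt)⟩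
    -- MONO′_i from MONO_i and MONO″_i through the Neumann terms
    have hMONO' : ∀ w : ℕ → ℝ, (∀ m, 0 ≤ w m) → (∀ m, w (m + 1) ≤ w m) → (∀ m, N < m → w m = 0) →
        ∀ m, RL i (SA i w) (m + 1) ≤ RL i (SA i w) m := by
      intro w hw0 hwa hwt
      have hwrec : ∀ m, SA i w m = w m - RA (i + 1) (SA i w) m - RL i (SA i w) m := fun m => by
        rw [(hSA i w hwt).2 m, aggregate_read_succ hRL hRA hKA]; ring
      exact antitone_young_drops (RO := RA (i + 1)) (Ry := RL i) (SO := SA (i + 1)) (Sy := SL i)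
        (hRA (i + 1)) (hRL i) (hSA (i + 1)) (hSL i) hMONO hMONO2 hw0 hwa hwt (hSA i w hwt).1 hwrec
    refine ⟨?_, ?_⟩
    · intro m k hk hkn
      rcases Nat.lt_or_ge i k with hik | hik
      · rw [hβold i m k hi1 hik hkn]
        exact div_nonneg (hBN m k (by omega) hkn) (by linarith [hρ1 m])
      · have : k = i := by omega
        subst this
        rw [hβnew k m hi1 hin]
        exact div_nonneg (hρ0 m) (by linarith [hρ1 m])
    · intro e he0 hea het
      have hεrec : ∀ m, SA i e m = e m - RA (i + 1) (SA i e) m - RL i (SA i e) m := fun m => by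
        rw [(hSA i e het).2 m, aggregate_read_succ hRL hRA hKA]; ring
      have hcomp := nonneg_of_age_composition_antitone (RO := RA (i + 1)) (Ry := RL i) (SO := SA (i + 1)) (Sy := SL i)
        (hRA (i + 1)) (hRL i) (hKL i) (hSA (i + 1)) (hSL i)
        (fun u hu0 hua hut => ⟨(hIH u hu0 hua hut).1, hKEY u hu0 hua hut, hMONO u hu0 hua hut⟩)
        he0 hea het (hSA i e het).1 hεrec
      have hε0 : ∀ m, 0 ≤ SA i e m := fun m => (hcomp m).1
      have hsand := surplus_sandwich (RO := RA (i + 1)) (Ry := RL i) (SO := SA (i + 1)) (Sy := SL i)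
        (A := fun w => (∀ m, 0 ≤ w m) ∧ ∀ m, w (m + 1) ≤ w m)
        (hRA (i + 1)) (hRL i) (hKL i) (hSA (i + 1)) (hSL i) het ⟨he0, hea⟩
        (fun u hu hut => ⟨(hIH u hu.1 hu.2 hut).1, hKEY u hu.1 hu.2 hut, hMONO u hu.1 hu.2 hut⟩)
        (hSA i e het).1 hεrec (ρ := ρ i) (hkey e he0 hea het)
        ⟨fun m => read_nonneg (hRL i) (hKL i) (fun m' _ => hε0 m') , hMONO' e he0 hea het⟩
      obtain ⟨_, hDRv⟩ := hIH e he0 hea het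
      refine ⟨hε0, fun m k hk hkn => ?_⟩
      have hle : ∀ m', SA i e m' ≤ SA (i + 1) e m' := fun m' => (hsand m').2
      have hlow : (1 - ρ i m) * SA (i + 1) e m ≤ SA i e m := (hsand m).1
      rcases Nat.lt_or_ge i k with hik | hik
      · rw [hβold i m k hi1 hik hkn]
        exact drop_ratio_step (D := fun u => RL k u m)
          (fun u u' hu0 huu' => read_le_read (hRL k) (hKL k) fun m' _ => huu' m')
          hε0 hle hlow (hρ1 m) (hBN m k (by omega) hkn) (hDRv m k (by omega) hkn)
      · have : k = i := by omega
        subst this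
        rw [hβnew k m hi1 hin]
        exact drop_ratio_step (D := fun u => RL k u m)
          (fun u u' hu0 huu' => read_le_read (hRL k) (hKL k) fun m' _ => huu' m')
          hε0 hle hlow (hρ1 m) (hρ0 m) (hkey e he0 hea het m)

/-- **ROUTE (N), FIRST ORDER, END — MODULO CONDITIONAL MONO″ AND STATIC CUMULATIVE DOMINATION.** [folklore] -/
theorem nonneg_of_chain_closes_of_criteria
    (hKL : ∀ i m l, 0 ≤ KL i m l) (hKLN : ∀ i m l, N ≤ l → KL i m l = 0) (hKLy : ∀ i m l, y i ≤ l → KL i m l = 0)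
    (hRL : ∀ i v m, RL i v m = ∑ l ∈ range N, KL i m l * v (m + 1 + l))
    (hRA : ∀ i v m, RA i v m = ∑ l ∈ range N, KA i m l * v (m + 1 + l))
    (hKA : ∀ i m l, KA i m l = KL i m l + KA (i + 1) m l) (hKAtop : ∀ m l, KA (n + 1) m l = 0)
    (hSL : ∀ i (w : ℕ → ℝ), (∀ m, N < m → w m = 0) → (∀ m, N < m → SL i w m = 0) ∧ ∀ m, SL i w m = w m - RL i (SL i w) m)
    (hSA : ∀ i (w : ℕ → ℝ), (∀ m, N < m → w m = 0) → (∀ m, N < m → SA i w m = 0) ∧ ∀ m, SA i w m = w m - RA i (SA i w) m)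
    (hy : ∀ i, 1 ≤ i → i ≤ n → 1 ≤ y i ∧ y i ≤ N)
    (hθ0 : ∀ k m l, 0 ≤ θ k m l) (hpers : ∀ k m l i', (1 - θ k m l) * KL k m (i' + l) ≤ KL k (m + l) i')
    (hθmono : ∀ k m l l', l ≤ l' → θ k m l ≤ θ k m l')
    {ρ : ℕ → ℕ → ℝ} {β : ℕ → ℕ → ℕ → ℝ}
    (hρ : ∀ i m, 1 ≤ i → i ≤ n → ρ i m = (∑ l ∈ range N, KL i m l) * (1 + ∑ k ∈ Ioc i n, θ k m (y i) * β (i + 1) m k) /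
      (1 - ∑ k ∈ Ioc i n, ∑ l ∈ range (y i), KL k m l))
    (hβnew : ∀ i m, 1 ≤ i → i ≤ n → β i m i = ρ i m / (1 - ρ i m))
    (hβold : ∀ i m k, 1 ≤ i → i < k → k ≤ n → β i m k = β (i + 1) m k / (1 - ρ i m))
    (hΩ1 : ∀ i m, 1 ≤ i → i ≤ n → ∑ k ∈ Ioc i n, ∑ l ∈ range (y i), KL k m l < 1)
    (hclose : ∀ i m, 1 ≤ i → i ≤ n → ρ i m < 1)
    (hcumL : ∀ k, 1 ≤ k → k ≤ n → ∀ m L, ∑ l ∈ range (L + 1), KL k (m + 1) l ≤ ∑ l ∈ range (L + 2), KL k m l)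
    (hMONO2c : ∀ i, 1 ≤ i → i ≤ n → ∀ w : ℕ → ℝ, (∀ m, 0 ≤ w m) → (∀ m, w (m + 1) ≤ w m) → (∀ m, N < m → w m = 0) →
      (∀ m, 0 ≤ SA (i + 1) w m) → (∀ m, RL i (SA (i + 1) w) m ≤ SA (i + 1) w m) →
      ∀ m, RL i (SL i (SA (i + 1) w)) (m + 1) ≤ RL i (SL i (SA (i + 1) w)) m)
    {e ε : ℕ → ℝ} (he0 : ∀ m, 0 ≤ e m) (hea : ∀ m, e (m + 1) ≤ e m) (het : ∀ m, N < m → e m = 0)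
    (hεt : ∀ m, N < m → ε m = 0) (hεrec : ∀ m, ε m = e m - RA 1 ε m) : ∀ m, 0 ≤ ε m := by
  rcases Nat.eq_zero_or_pos n with hn0 | hn0
  · subst hn0; intro m; rw [hεrec m, hRA, sum_eq_zero fun l _ => by rw [hKAtop, zero_mul]]; linarith [he0 m]
  have h := (nonneg_and_drop_ratio_all_ages_of_criteria hKL hKLN hKLy hRL hRA hKA hKAtop hSL hSA hy hθ0 hpers hθmono hρ hβnew hβold hΩ1 hclose
    hcumL hMONO2c 1 le_rfl (by omega)).2 e he0 hea het
  have heq : ∀ m, ε m = SA 1 e m := sol_unique (hRA 1) hεt hεrec (hSA 1 e het).1 (hSA 1 e het).2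
  exact fun m => (heq m).symm ▸ h.1 m

/-! ## §5 The END with MONO″ replaced by the read-decay inequality of (E81a) -/

/-- **ROUTE (N), FIRST ORDER, END — MODULO TWO STATIC-TYPE FAMILIES**: cumulative domination of the lone kernels of the ages `≥ 2` (for MONOa) and the
READ-DECAY INEQUALITY of (E81a) for the young reads `A = RL i v` of the old surpluses `v = SA (i+1) w` (first-order bound `U = A`):
`M i n' · A (n'+1) ≤ A n' − A (n'+1)` with the shift-domination defect `M i` of the young kernel — asked only for admissible `w` and given `v ≥ 0`, KEY_i.
[folklore] -/
theorem nonneg_of_chain_closes_of_read_decay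
    (hKL : ∀ i m l, 0 ≤ KL i m l) (hKLN : ∀ i m l, N ≤ l → KL i m l = 0) (hKLy : ∀ i m l, y i ≤ l → KL i m l = 0)
    (hRL : ∀ i v m, RL i v m = ∑ l ∈ range N, KL i m l * v (m + 1 + l))
    (hRA : ∀ i v m, RA i v m = ∑ l ∈ range N, KA i m l * v (m + 1 + l))
    (hKA : ∀ i m l, KA i m l = KL i m l + KA (i + 1) m l) (hKAtop : ∀ m l, KA (n + 1) m l = 0)
    (hSL : ∀ i (w : ℕ → ℝ), (∀ m, N < m → w m = 0) → (∀ m, N < m → SL i w m = 0) ∧ ∀ m, SL i w m = w m - RL i (SL i w) m)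
    (hSA : ∀ i (w : ℕ → ℝ), (∀ m, N < m → w m = 0) → (∀ m, N < m → SA i w m = 0) ∧ ∀ m, SA i w m = w m - RA i (SA i w) m)
    (hy : ∀ i, 1 ≤ i → i ≤ n → 1 ≤ y i ∧ y i ≤ N)
    (hθ0 : ∀ k m l, 0 ≤ θ k m l) (hpers : ∀ k m l i', (1 - θ k m l) * KL k m (i' + l) ≤ KL k (m + l) i')
    (hθmono : ∀ k m l l', l ≤ l' → θ k m l ≤ θ k m l')
    {ρ : ℕ → ℕ → ℝ} {β : ℕ → ℕ → ℕ → ℝ}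
    (hρ : ∀ i m, 1 ≤ i → i ≤ n → ρ i m = (∑ l ∈ range N, KL i m l) * (1 + ∑ k ∈ Ioc i n, θ k m (y i) * β (i + 1) m k) /
      (1 - ∑ k ∈ Ioc i n, ∑ l ∈ range (y i), KL k m l))
    (hβnew : ∀ i m, 1 ≤ i → i ≤ n → β i m i = ρ i m / (1 - ρ i m))
    (hβold : ∀ i m k, 1 ≤ i → i < k → k ≤ n → β i m k = β (i + 1) m k / (1 - ρ i m))
    (hΩ1 : ∀ i m, 1 ≤ i → i ≤ n → ∑ k ∈ Ioc i n, ∑ l ∈ range (y i), KL k m l < 1)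
    (hclose : ∀ i m, 1 ≤ i → i ≤ n → ρ i m < 1)
    (hcumL : ∀ k, 1 ≤ k → k ≤ n → ∀ m L, ∑ l ∈ range (L + 1), KL k (m + 1) l ≤ ∑ l ∈ range (L + 2), KL k m l)
    {M : ℕ → ℕ → ℝ} (hM : ∀ i n', M i n' = KL i n' 0 + ∑ l ∈ range (N - 1), max (KL i n' (l + 1) - KL i (n' + 1) l) 0)
    (hdecay : ∀ i, 1 ≤ i → i ≤ n → ∀ w : ℕ → ℝ, (∀ m, 0 ≤ w m) → (∀ m, w (m + 1) ≤ w m) → (∀ m, N < m → w m = 0) →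
      (∀ m, 0 ≤ SA (i + 1) w m) → (∀ m, RL i (SA (i + 1) w) m ≤ SA (i + 1) w m) →
      ∀ n', M i n' * RL i (SA (i + 1) w) (n' + 1) ≤ RL i (SA (i + 1) w) n' - RL i (SA (i + 1) w) (n' + 1))
    {e ε : ℕ → ℝ} (he0 : ∀ m, 0 ≤ e m) (hea : ∀ m, e (m + 1) ≤ e m) (het : ∀ m, N < m → e m = 0)
    (hεt : ∀ m, N < m → ε m = 0) (hεrec : ∀ m, ε m = e m - RA 1 ε m) : ∀ m, 0 ≤ ε m := by
  refine nonneg_of_chain_closes_of_criteria hKL hKLN hKLy hRL hRA hKA hKAtop hSL hSA hy hθ0 hpers hθmono hρ hβnew hβold hΩ1 hclose hcumL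
    (fun i hi1 hin w hw0 hwa hwt hv0 hkey => ?_) he0 hea het hεt hεrec
  have hvt := (hSA (i + 1) w hwt).1
  have htv := sol_nonneg_le_of_supersol (hRL i) (hKL i) hv0 hkey (hSL i _ hvt).1 (hSL i _ hvt).2
  exact young_drops_antitone_of_read_decay hRL hKL hSL (hM i) hv0 hvt hkey
    (fun m => (drops_mem (hRL i) (hKL i) htv m).2) (hdecay i hi1 hin w hw0 hwa hwt hv0 hkey)

end Induction

end Summit.QuantumFields.BalabanUV.Beta.EriceRemainderEnclosureHistoryAutonomyComparisonAgeCompositionReadMonotone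

end
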